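import Summits.CriticalPhenomena.PercolationContinuityZ3.Theorems.PercNearOneGluingNoHeavyLowerTailSahiCombUnique
import Summits.CriticalPhenomena.PercolationContinuityZ3.Theorems.PercNearOneGluingNoHeavyLowerTailSahiC3CombCube

/-!
# The comb (tensor-Bernstein) hierarchy for Sahi's `E_k`, VIII: BRIDGES — the uniform `k`-copy coefficients `combCoeff`
# ARE the tree's three-copy fibre sums `combCoef3` (`k = 3`) and bitmask coefficients `e4Coef` (`k = 4`); the kernel cells
# and the three-partition conjecture (★★) in the uniform vocabulary

Support file of the one-cut programme (crux `NoHeavyLowerTail`, stmt-CriticalPhenomena-4575; cell `prim-masterthm`, seat P5).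
The tree now holds three explicit tensor-Bernstein expansions of Sahi's functional on product measures: the uniform one
(`SahiComb.sahiE_bernoulliWeight_eq_sum_combCoeff`, coefficients `SahiComb.combCoeff k`, any `k`), prim-l12 P3's three-copy one
(`ThreePartition.sahiE_three_ind_bernstein`, coefficients `ThreePartition.combCoef3`) and prim-masterthm P3's bitmask one at `k = 4`
(`SahiC4CombBridge.sahiE_four_ind_bernstein`, coefficients `SahiC4Cube.e4Coef`).  By uniqueness of tensor-Bernstein coefficients
(`ThreePartition.bern_coeff_unique` / `SahiComb.bern_coeff_unique`) they coincide, so every result about one is a result about all: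

* **`SahiComb.combCoef3_eq_combCoeff`** (`k = 3`), **`SahiComb.e4Coef_eq_combCoeff`** (`k = 4`) — the identities;
* `threePartitionPositivityTwisted_iff_combEndPos_three` — prim-l12 P3's twisted three-partition conjecture (★★) ⟺ ENDPOS(3)
  (⟺ the explicit (M⁺-3), `threePartitionPositivityTwisted_iff_masterFamilyCombCoeffNonneg_three`);
  `sahiE4CombPositivity_iff_combEndPos_four`, `sahiE4CombPositivity_iff_masterFamilyCombCoeffNonneg_four` — likewise at `k = 4`;
* KERNEL CELLS in the uniform vocabulary: **`combCoeff_three_ind_nonneg_of_card_le_three`** (every ground set with `≤ 3` elements,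
  from `SahiC3CombCube.combPos_sahiE_three_of_card_le_three`) and **`combCoeff_four_ind_nonneg_of_le_three`** (cubes `Fin m`, `m ≤ 3`,
  from `SahiC4Cube.sahiE4CombPositivityUpTo_three`): there every three-copy / four-copy comb coefficient of every tuple of increasing events is
  `≥ 0`, so every coefficient line is `≥ 0` (`combLine_three_nonneg_of_card_le_three`, `combLine_four_nonneg_of_le_three`).
Everything here is proved; axioms standard (the `k = 3, 4` cells rest on `decide`-checked certificates, no `native_decide`). [this work]
-/

noncomputable section

open scoped Classical

namespace Summit.CriticalPhenomena.PercolationContinuityZ3.Theorems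

open Finset Function
open Literature.Combinatorics.Sahi2008
open Literature.Probability.Percolation.DecisionTree (ind)
open SahiComb SahiC4Cube SahiC3Cube FourCopyCert SahiC4CombBridge

namespace SahiComb

/-- **`k = 3`: prim-l12 P3's three-copy fibre sums ARE the uniform three-copy comb coefficients** (two different three-copy kernels,
the same fibre sums). [this work] -/
theorem combCoef3_eq_combCoeff {ι : Type} [Fintype ι] (U V W : Set (Set ι)) (j : ι → ℕ) :
    ThreePartition.combCoef3 U V W j = combCoeff 3 ![ind U, ind V, ind W] j := by
  by_cases hj : j ∈ box (fun _ : ι => 3)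
  · exact ThreePartition.bern_coeff_unique
      (fun p => (ThreePartition.sahiE_three_ind_bernstein p U V W).symm.trans
        (sahiE_bernoulliWeight_eq_sum_combCoeff p 3 _)) hj
  · rw [ThreePartition.combCoef3_eq_zero_of_not_le U V W (fun h => hj (mem_box.2 h)),
      combCoeff_eq_zero_of_not_mem_box _ hj]

/-- **`k = 4`: prim-masterthm P3's bitmask coefficients ARE the uniform four-copy comb coefficients.** [this work] -/
theorem e4Coef_eq_combCoeff {m : ℕ} (A B C D : Set (Set (Fin m))) (k : Fin m → Fin 5) :
    (e4Coef m (encA m A) (encA m B) (encA m C) (encA m D) k : ℝ) = combCoeff 4 ![ind A, ind B, ind C, ind D] (keyProf k) := by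
  have h := ThreePartition.bern_coeff_unique
    (fun p => (sahiE_four_ind_bernstein p A B C D).symm.trans (sahiE_bernoulliWeight_eq_sum_combCoeff p 4 _))
    (keyProf_mem_box k)
  rwa [profKey_keyProf] at h

end SahiComb

/-! ### The `k = 3, 4` conjectures of the other seats in the uniform vocabulary -/

/-- **(★★) ⟺ ENDPOS(3)**: prim-l12 P3's twisted three-partition positivity is the one-axis propagation law of the three-copy comb
array. [this work] -/
theorem threePartitionPositivityTwisted_iff_combEndPos_three :
    ThreePartition.ThreePartitionPositivityTwisted ↔ CombEndPos 3 :=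
  ThreePartition.threePartitionPositivityTwisted_iff_masterFamilyCombPos_three.trans (combEndPos_iff_masterFamilyCombPos 3).symm

/-- (★★) ⟺ the explicit (M⁺-3). [this work] -/
theorem threePartitionPositivityTwisted_iff_masterFamilyCombCoeffNonneg_three :
    ThreePartition.ThreePartitionPositivityTwisted ↔ MasterFamilyCombCoeffNonneg 3 :=
  ThreePartition.threePartitionPositivityTwisted_iff_masterFamilyCombPos_three.trans
    (masterFamilyCombCoeffNonneg_iff_masterFamilyCombPos 3).symm

/-- **`SahiE4CombPositivity` ⟺ ENDPOS(4).** [this work] -/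
theorem sahiE4CombPositivity_iff_combEndPos_four : SahiE4CombPositivity ↔ CombEndPos 4 :=
  sahiE4CombPositivity_iff_masterFamilyCombPos_four.trans (combEndPos_iff_masterFamilyCombPos 4).symm

/-- `SahiE4CombPositivity` ⟺ the explicit (M⁺-4). [this work] -/
theorem sahiE4CombPositivity_iff_masterFamilyCombCoeffNonneg_four : SahiE4CombPositivity ↔ MasterFamilyCombCoeffNonneg 4 :=
  sahiE4CombPositivity_iff_masterFamilyCombPos_four.trans (masterFamilyCombCoeffNonneg_iff_masterFamilyCombPos 4).symm

/-! ### Kernel cells in the uniform vocabulary -/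

/-- **KERNEL CELL, `k = 3`**: on every ground set with at most three elements, every three-copy comb coefficient of every triple of
increasing events is `≥ 0` (prim-l12 P3's `decide`-checked cell, transported along relabellings there). [this work] -/
theorem combCoeff_three_ind_nonneg_of_card_le_three {ι : Type} [Fintype ι] (hι : Fintype.card ι ≤ 3)
    (U : Fin 3 → Set (Set ι)) (hU : ∀ i, IsUpperSet (U i)) (j : ι → ℕ) : 0 ≤ combCoeff 3 (fun i => ind (U i)) j :=
  (combPos_sahiE_iff_combCoeff_nonneg _).1
    ((ThreePartition.combPos_vec_iff U).2
      (SahiC3CombCube.combPos_sahiE_three_of_card_le_three hι (hU 0) (hU 1) (hU 2))) j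

/-- Hence every three-copy coefficient line is `≥ 0` on such ground sets. [this work] -/
theorem combLine_three_nonneg_of_card_le_three {ι : Type} [Fintype ι] (hι : Fintype.card ι ≤ 3)
    (U : Fin 3 → Set (Set ι)) (hU : ∀ i, IsUpperSet (U i)) (e : ι) (j : ι → ℕ) (t : ℕ) : 0 ≤ combLine 3 U e j t :=
  combCoeff_three_ind_nonneg_of_card_le_three hι U hU _

/-- **KERNEL CELL, `k = 4`**: on the cubes `2^{Fin m}`, `m ≤ 3`, every four-copy comb coefficient of every quadruple of increasing
events is `≥ 0` (prim-masterthm P3's `decide`-checked `sahiE4CombPositivityUpTo_three`, via `e4Coef = combCoeff 4`). [this work] -/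
theorem combCoeff_four_ind_nonneg_of_le_three {m : ℕ} (hm : m ≤ 3) (U : Fin 4 → Set (Set (Fin m)))
    (hU : ∀ i, IsUpperSet (U i)) (j : Fin m → ℕ) : 0 ≤ combCoeff 4 (fun i => ind (U i)) j := by
  have h := SahiC4CombBridge.combPos_of_e4Coef_nonneg
    (sahiE4CombPositivityUpTo_three m hm (U 0) (U 1) (U 2) (U 3) (hU 0) (hU 1) (hU 2) (hU 3))
  rw [← SahiC4CombBridge.ind_vec4 U] at h
  exact (combPos_sahiE_iff_combCoeff_nonneg _).1 h j

/-- Hence every four-copy coefficient line is `≥ 0` on such cubes. [this work] -/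
theorem combLine_four_nonneg_of_le_three {m : ℕ} (hm : m ≤ 3) (U : Fin 4 → Set (Set (Fin m)))
    (hU : ∀ i, IsUpperSet (U i)) (e : Fin m) (j : Fin m → ℕ) (t : ℕ) : 0 ≤ combLine 4 U e j t :=
  combCoeff_four_ind_nonneg_of_le_three hm U hU _

end Summit.CriticalPhenomena.PercolationContinuityZ3.Theorems
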